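import Summits.CriticalPhenomena.Ising3DConformalLimit.Theorems.SubPtolemyInterlacingSubPtolemyFloorScreeningCertificate
import HarnessLib

/-!
# The window of the screening engine `ScreeningGain` — normal forms (crux item stmt-CriticalPhenomena-15703,
# line `source-cluster-screening`, registered stub `stub_screenedLemma25`; lead seat
# `prover-line-stmt-CriticalPhenomena-15703-c6-0`)

The engine of the line (and child `ScreeningGain` of the prepared decomposition SPLIT-D2) is the screened
torus Lemma 2.5 `STL25(s, C)` of Duminil-Copin–Panis, stated UNFOLDED (as in
`SubPtolemyInterlacingSubPtolemyFloorScreeningCertificate.lean`): for every `n ≥ 1`, every even torus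
`L ≥ 4n + 2` and every direction, the random-current left side summed over neighbour pairs of `Λ_n` is at
most `C n^{-s}` times the printed right side. Two bookkeeping facts every seat on the engine uses, proved
here once (pure monotonicity over the landed calibration `screenedLemma25_zero_one`):

* `screenedLemma25_mono` — `STL25(s, C)` is monotone: it implies `STL25(s', C')` whenever `s' ≤ s` and
  `0 ≤ C ≤ C'` (the gain factor `C n^{-s}` only grows).
* `screenedLemma25_of_eventually` — **small boxes are free**: if the screened inequality holds with gain
  `C n^{-s}` (`s ≥ 0`, `C > 0`) for all `n ≥ N₀` only, then `STL25(s, max C (N₀^s))` holds for ALL `n ≥ 1`,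
  because for `n < N₀` the printed lemma (`s = 0`, `C = 1`, a theorem) already gives the bound with factor
  `1 ≤ N₀^s n^{-s}`. So a proof of the engine may fix any finite threshold `N₀` and argue asymptotically.

References: H. Duminil-Copin, R. Panis, CMP 406 (2025), arXiv:2404.05700, Lemma 2.5.
-/

noncomputable section

open Finset Filter Topology

namespace Summit.CriticalPhenomena.Ising3DConformalLimit.SubPtolemyFloorScreening

open Literature.Probability.LatticeModels Literature.Probability.LatticeModels.DCPLower
  Literature.Probability.LatticeModels.DCPNearCritical
open Summit.CriticalPhenomena.Ising3DConformalLimit.Theses.SubPtolemyInterlacing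
open scoped ENNReal symmDiff Classical

/-- **Monotonicity of the screened torus Lemma 2.5 in its gain.** If `STL25(s, C)` holds and `s' ≤ s`,
`0 ≤ C ≤ C'`, then `STL25(s', C')` holds: for `n ≥ 1`, `C n^{-s} ≤ C' n^{-s'}`.
[cite: DuminilCopinPanis2025LowerBounds, Lemma 2.5] -/
theorem screenedLemma25_mono (s C s' C' : ℝ) (hss' : s' ≤ s) (hC : 0 ≤ C) (hCC' : C ≤ C')
    (hE : (∀ (n : ℕ) (_hn : 1 ≤ n) (L : ℕ) [NeZero L] (hL : Even L) (hnL : 4 * n + 2 ≤ L) (δ : Fin 3 × Bool),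
      (∑ x ∈ box 3 n, ∑ y ∈ box 3 n,
        if (zdGraph 3).Adj x y then
          ∑' nc : edgesIn (torusGraph 3 L) univ → ℕ,
            ind (csources (torusGraph 3 L) univ nc = ∅ ∧
                CSupp (torusGraph 3 L) univ (edgesIn (torusGraph 3 L) univ) nc) *
              cweight (torusGraph 3 L) univ (criticalBeta 3) nc *
              (ind (¬ (isFoldable_dir hL (by omega) n δ).ConnFix ((isFoldable_dir hL (by omega) n δ).fold nc)
                      (Torus.proj L (0 : Site 3)) ∧
                    ¬ (isFoldable_dir hL (by omega) n δ).ConnFix ((isFoldable_dir hL (by omega) n δ).fold nc)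
                      (Torus.proj L x) ∧
                    (isFoldable_dir hL (by omega) n δ).ConnFix ((isFoldable_dir hL (by omega) n δ).fold nc)
                      (Torus.proj L y)) *
                ENNReal.ofReal (isingTwoPoint (torusGraph 3 L)
                  (((box 3 n).filter fun z => ¬ (isFoldable_dir hL (by omega) n δ).ConnFix
                      ((isFoldable_dir hL (by omega) n δ).fold nc) (Torus.proj L z)).image (Torus.proj L))
                  (criticalBeta 3) 0 .free (Torus.proj L (0 : Site 3)) (Torus.proj L x)))
        else 0) ≤
      ENNReal.ofReal (C * (n : ℝ) ^ (-s)) *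
        ∑ x ∈ box 3 n, ∑ y ∈ box 3 n,
          if (zdGraph 3).Adj x y then
            (currentZ (torusGraph 3 L) univ (criticalBeta 3) (edgesIn (torusGraph 3 L) univ)
                  ({Torus.proj L (0 : Site 3)} ∆ {Torus.proj L x}) -
                currentZ (torusGraph 3 L) univ (criticalBeta 3) (edgesIn (torusGraph 3 L) univ)
                  ({Torus.proj L (0 : Site 3)} ∆ {dirTheta L n δ (Torus.proj L x)})) *
              ENNReal.ofReal (isingTwoPoint (torusGraph 3 L) univ (criticalBeta 3) 0 .free (Torus.proj L y)
                (dirTheta L n δ (Torus.proj L y)))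
          else 0)) :
    (∀ (n : ℕ) (_hn : 1 ≤ n) (L : ℕ) [NeZero L] (hL : Even L) (hnL : 4 * n + 2 ≤ L) (δ : Fin 3 × Bool),
      (∑ x ∈ box 3 n, ∑ y ∈ box 3 n,
        if (zdGraph 3).Adj x y then
          ∑' nc : edgesIn (torusGraph 3 L) univ → ℕ,
            ind (csources (torusGraph 3 L) univ nc = ∅ ∧
                CSupp (torusGraph 3 L) univ (edgesIn (torusGraph 3 L) univ) nc) *
              cweight (torusGraph 3 L) univ (criticalBeta 3) nc *
              (ind (¬ (isFoldable_dir hL (by omega) n δ).ConnFix ((isFoldable_dir hL (by omega) n δ).fold nc)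
                      (Torus.proj L (0 : Site 3)) ∧
                    ¬ (isFoldable_dir hL (by omega) n δ).ConnFix ((isFoldable_dir hL (by omega) n δ).fold nc)
                      (Torus.proj L x) ∧
                    (isFoldable_dir hL (by omega) n δ).ConnFix ((isFoldable_dir hL (by omega) n δ).fold nc)
                      (Torus.proj L y)) *
                ENNReal.ofReal (isingTwoPoint (torusGraph 3 L)
                  (((box 3 n).filter fun z => ¬ (isFoldable_dir hL (by omega) n δ).ConnFix
                      ((isFoldable_dir hL (by omega) n δ).fold nc) (Torus.proj L z)).image (Torus.proj L))
                  (criticalBeta 3) 0 .free (Torus.proj L (0 : Site 3)) (Torus.proj L x)))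
        else 0) ≤
      ENNReal.ofReal (C' * (n : ℝ) ^ (-s')) *
        ∑ x ∈ box 3 n, ∑ y ∈ box 3 n,
          if (zdGraph 3).Adj x y then
            (currentZ (torusGraph 3 L) univ (criticalBeta 3) (edgesIn (torusGraph 3 L) univ)
                  ({Torus.proj L (0 : Site 3)} ∆ {Torus.proj L x}) -
                currentZ (torusGraph 3 L) univ (criticalBeta 3) (edgesIn (torusGraph 3 L) univ)
                  ({Torus.proj L (0 : Site 3)} ∆ {dirTheta L n δ (Torus.proj L x)})) *
              ENNReal.ofReal (isingTwoPoint (torusGraph 3 L) univ (criticalBeta 3) 0 .free (Torus.proj L y)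
                (dirTheta L n δ (Torus.proj L y)))
          else 0) := by
  intro n hn L _ hL hnL δ
  refine le_trans (hE n hn L hL hnL δ) ?_
  have hn1 : (1 : ℝ) ≤ n := by exact_mod_cast hn
  have hnpos : (0 : ℝ) < n := by positivity
  have hgain : C * (n : ℝ) ^ (-s) ≤ C' * (n : ℝ) ^ (-s') :=
    calc C * (n : ℝ) ^ (-s) ≤ C' * (n : ℝ) ^ (-s) :=
          mul_le_mul_of_nonneg_right hCC' (Real.rpow_nonneg hnpos.le _)
      _ ≤ C' * (n : ℝ) ^ (-s') :=
          mul_le_mul_of_nonneg_left (Real.rpow_le_rpow_of_exponent_le hn1 (neg_le_neg hss'))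
            (hC.trans hCC')
  exact mul_le_mul' (ENNReal.ofReal_le_ofReal hgain) le_rfl

/-- **Small boxes are free.** If the screened inequality with gain `C n^{-s}` holds for
all `n ≥ N₀` (`s ≥ 0`), then `STL25(s, max C (N₀^s))` holds for every `n ≥ 1`: below `N₀` the printed Lemma 2.5
(`screenedLemma25_zero_one`) bounds the left side by the right side, and `1 ≤ N₀^s · n^{-s}` there.
[cite: DuminilCopinPanis2025LowerBounds, Lemma 2.5] -/
theorem screenedLemma25_of_eventually (s C : ℝ) (hs : 0 ≤ s) (N₀ : ℕ)
    (hE : (∀ (n : ℕ) (_hn : 1 ≤ n) (_hN : N₀ ≤ n) (L : ℕ) [NeZero L] (hL : Even L) (hnL : 4 * n + 2 ≤ L) (δ : Fin 3 × Bool),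
      (∑ x ∈ box 3 n, ∑ y ∈ box 3 n,
        if (zdGraph 3).Adj x y then
          ∑' nc : edgesIn (torusGraph 3 L) univ → ℕ,
            ind (csources (torusGraph 3 L) univ nc = ∅ ∧
                CSupp (torusGraph 3 L) univ (edgesIn (torusGraph 3 L) univ) nc) *
              cweight (torusGraph 3 L) univ (criticalBeta 3) nc *
              (ind (¬ (isFoldable_dir hL (by omega) n δ).ConnFix ((isFoldable_dir hL (by omega) n δ).fold nc)
                      (Torus.proj L (0 : Site 3)) ∧
                    ¬ (isFoldable_dir hL (by omega) n δ).ConnFix ((isFoldable_dir hL (by omega) n δ).fold nc)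
                      (Torus.proj L x) ∧
                    (isFoldable_dir hL (by omega) n δ).ConnFix ((isFoldable_dir hL (by omega) n δ).fold nc)
                      (Torus.proj L y)) *
                ENNReal.ofReal (isingTwoPoint (torusGraph 3 L)
                  (((box 3 n).filter fun z => ¬ (isFoldable_dir hL (by omega) n δ).ConnFix
                      ((isFoldable_dir hL (by omega) n δ).fold nc) (Torus.proj L z)).image (Torus.proj L))
                  (criticalBeta 3) 0 .free (Torus.proj L (0 : Site 3)) (Torus.proj L x)))
        else 0) ≤
      ENNReal.ofReal (C * (n : ℝ) ^ (-s)) *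
        ∑ x ∈ box 3 n, ∑ y ∈ box 3 n,
          if (zdGraph 3).Adj x y then
            (currentZ (torusGraph 3 L) univ (criticalBeta 3) (edgesIn (torusGraph 3 L) univ)
                  ({Torus.proj L (0 : Site 3)} ∆ {Torus.proj L x}) -
                currentZ (torusGraph 3 L) univ (criticalBeta 3) (edgesIn (torusGraph 3 L) univ)
                  ({Torus.proj L (0 : Site 3)} ∆ {dirTheta L n δ (Torus.proj L x)})) *
              ENNReal.ofReal (isingTwoPoint (torusGraph 3 L) univ (criticalBeta 3) 0 .free (Torus.proj L y)
                (dirTheta L n δ (Torus.proj L y)))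
          else 0)) :
    (∀ (n : ℕ) (_hn : 1 ≤ n) (L : ℕ) [NeZero L] (hL : Even L) (hnL : 4 * n + 2 ≤ L) (δ : Fin 3 × Bool),
      (∑ x ∈ box 3 n, ∑ y ∈ box 3 n,
        if (zdGraph 3).Adj x y then
          ∑' nc : edgesIn (torusGraph 3 L) univ → ℕ,
            ind (csources (torusGraph 3 L) univ nc = ∅ ∧
                CSupp (torusGraph 3 L) univ (edgesIn (torusGraph 3 L) univ) nc) *
              cweight (torusGraph 3 L) univ (criticalBeta 3) nc *
              (ind (¬ (isFoldable_dir hL (by omega) n δ).ConnFix ((isFoldable_dir hL (by omega) n δ).fold nc)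
                      (Torus.proj L (0 : Site 3)) ∧
                    ¬ (isFoldable_dir hL (by omega) n δ).ConnFix ((isFoldable_dir hL (by omega) n δ).fold nc)
                      (Torus.proj L x) ∧
                    (isFoldable_dir hL (by omega) n δ).ConnFix ((isFoldable_dir hL (by omega) n δ).fold nc)
                      (Torus.proj L y)) *
                ENNReal.ofReal (isingTwoPoint (torusGraph 3 L)
                  (((box 3 n).filter fun z => ¬ (isFoldable_dir hL (by omega) n δ).ConnFix
                      ((isFoldable_dir hL (by omega) n δ).fold nc) (Torus.proj L z)).image (Torus.proj L))
                  (criticalBeta 3) 0 .free (Torus.proj L (0 : Site 3)) (Torus.proj L x)))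
        else 0) ≤
      ENNReal.ofReal (max C ((N₀ : ℝ) ^ s) * (n : ℝ) ^ (-s)) *
        ∑ x ∈ box 3 n, ∑ y ∈ box 3 n,
          if (zdGraph 3).Adj x y then
            (currentZ (torusGraph 3 L) univ (criticalBeta 3) (edgesIn (torusGraph 3 L) univ)
                  ({Torus.proj L (0 : Site 3)} ∆ {Torus.proj L x}) -
                currentZ (torusGraph 3 L) univ (criticalBeta 3) (edgesIn (torusGraph 3 L) univ)
                  ({Torus.proj L (0 : Site 3)} ∆ {dirTheta L n δ (Torus.proj L x)})) *
              ENNReal.ofReal (isingTwoPoint (torusGraph 3 L) univ (criticalBeta 3) 0 .free (Torus.proj L y)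
                (dirTheta L n δ (Torus.proj L y)))
          else 0) := by
  intro n hn L _ hL hnL δ
  have hn1 : (1 : ℝ) ≤ n := by exact_mod_cast hn
  have hnpos : (0 : ℝ) < n := by positivity
  have hns : 0 ≤ (n : ℝ) ^ (-s) := Real.rpow_nonneg hnpos.le _
  by_cases hN : N₀ ≤ n
  · refine le_trans (hE n hn hN L hL hnL δ) ?_
    have hgain : C * (n : ℝ) ^ (-s) ≤ max C ((N₀ : ℝ) ^ s) * (n : ℝ) ^ (-s) :=
      mul_le_mul_of_nonneg_right (le_max_left _ _) hns
    exact mul_le_mul' (ENNReal.ofReal_le_ofReal hgain) le_rfl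
  · replace hN : n < N₀ := not_le.mp hN
    refine le_trans (screenedLemma25_zero_one n hn L hL hnL δ) ?_
    have hN0 : (n : ℝ) ≤ N₀ := by exact_mod_cast hN.le
    have hgain : 1 * (n : ℝ) ^ (-(0 : ℝ)) ≤ max C ((N₀ : ℝ) ^ s) * (n : ℝ) ^ (-s) := by
      rw [neg_zero, Real.rpow_zero, mul_one]
      have h1 : (N₀ : ℝ) ^ s * (n : ℝ) ^ (-s) ≥ 1 := by
        rw [Real.rpow_neg hnpos.le, ge_iff_le, ← div_eq_mul_inv, le_div_iff₀ (Real.rpow_pos_of_pos hnpos s),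
          one_mul]
        exact Real.rpow_le_rpow hnpos.le hN0 hs
      calc (1 : ℝ) ≤ (N₀ : ℝ) ^ s * (n : ℝ) ^ (-s) := h1
        _ ≤ max C ((N₀ : ℝ) ^ s) * (n : ℝ) ^ (-s) := mul_le_mul_of_nonneg_right (le_max_right _ _) hns
    exact mul_le_mul' (ENNReal.ofReal_le_ofReal hgain) le_rfl

end Summit.CriticalPhenomena.Ising3DConformalLimit.SubPtolemyFloorScreening

end
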